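import Summits.AtomisticToContinuum.FouriersLaw.Theses.JunctionLocality
import Literature.MathematicalPhysics.KineticTheory.LangevinChainGibbs
import Literature.Barriers.AtomisticToContinuum.HarmonicCrystalBallisticProofs

/-!
# Disproof of `ConductanceLowerBound` — findings (crux disprover, generation 2)

Crux item `stmt-AtomisticToContinuum-11749` =
`Summit.AtomisticToContinuum.FouriersLaw.Theses.JunctionLocality.ConductanceLowerBound`
(shared verbatim by routes JunctionLocality (rank 4), StaticAbelianSqueeze (rank 6),
ParityLiouvilleSeed (support)): for `pinnedChain ω₂ lam β γ` (all `> 0`), under weak-NESS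
uniqueness, along every steady-state family and every `T > 0`, the finite-length response
coefficients `D_N(T) = lim_{δ→0,δ≠0} totalCurrent(μ_{N,T+δ/2,T-δ/2})/δ` satisfy
`∃ c > 0 ∃ N₁ ∀ N ≥ N₁, c ≤ D_N` (`liminf_N D_N > 0`: the chain is not a thermal insulator).

VERDICT (cycle 1 of this seat, 2026-08-15): **RESISTS.** No Lean refutation is possible short of
refuting the conjunct `FouriersLaw` itself (§1), and physically a kill is a clean, translation-
invariant, pinned anharmonic chain that is a PERFECT insulator at some `T > 0` — no such
mechanism is in print (§7). What this file establishes, all `sorry`-free: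

* §0 `crux_iff` — read-back of the statement in named pieces (`UniqAt`, `IsSteadyFamily`,
  `IsResponse`, `LowerBound`), `Iff.rfl` with the route decl.
* §1 `of_fouriersLaw : FouriersLaw → ConductanceLowerBound` — the crux is a COROLLARY of the
  sub-problem statement (so `¬crux ⇒ ¬FouriersLaw`; irrefutable unless the conjunct is false).
* §2 LOAD-BEARING ANALYSIS (given the route's own support item `NessUnique`, which every
  refutation must discharge because uniqueness is an antecedent of the crux):
  `false_without_steadyFamily`, `false_without_response`, `false_without_posTemp`
  (each: `NessUnique → ¬ <crux with that hypothesis dropped>`).  §2b NOT load-bearing: `0 < lam`,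
  `0 < β` (LANDED as `…/Theorems/ConductanceLowerBound/Negative/HarmonicCornerLowerBound.lean`,
  p69735, commit 060f427731f2) — `harmonic_corner`: along the proved Gaussian family of the pinned HARMONIC chain the
  response exists, satisfies `LowerBound`, and tends to `+∞` (`harmonic_corner_lowerBound_not_nonBallistic`:
  (C) true while (B) `NonBallistic` false) — anharmonicity is the obstacle, never the engine.
* §3 THE BATH-FREE MEMBER `γ = 0` (new, unconditional; LANDED as
  `…/Theorems/ConductanceLowerBound/Negative/GammaZeroNonUniqueness.lean`, p69446): `isSteadyState_dirac_origin` and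
  `isSteadyState_gibbs_gamma_zero` — at `γ = 0` the Dirac mass at the mechanical equilibrium AND
  every Gibbs measure are weak steady states for ALL nominal bath temperatures; hence
  `not_uniqAt_gamma_zero : ¬ UniqAt ω₂ lam β 0` (weak-NESS uniqueness FAILS without baths, so the
  crux is VACUOUS at `γ = 0` — `0 < γ` is load-bearing only through the uniqueness antecedent) and
  `false_without_baths_or_uniqueness` (drop uniqueness and allow `γ = 0`: the currentless Dirac
  family refutes the lower bound).  Dropping uniqueness ALONE (`γ > 0`) is NOT refutable short of
  `¬FouriersLaw`: `of_fouriersLaw_withoutUniqueness` (§2) shows `FouriersLaw → WithoutUniqueness →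
  crux` (clause (ii) of the conjunct is itself stated for every steady-state family).
* §4 REDUCTION TO NON-INSULATION (new; §4–§5 LANDED as
  `…/Theorems/ConductanceLowerBound/Negative/NotInsulatorReduction.lean`, p69553, commit 8755bdf1cf56;
  decls `Summit.AtomisticToContinuum.FouriersLaw.Theorems.conductanceLowerBound_iff_frequently`,
  `…_insulator_or_lowerBound`, `…_iff_noPerfectInsulator`, `…_seq_of_superadditive_frequently`):
  `NotInsulator` := the crux with its conclusion weakened to
  `∃ c > 0, D_N ≥ c for infinitely many N` (`limsup_N D_N > 0`).  `crux_iff_notInsulator :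
  SuperadditiveResistance → PositiveConductance → (ConductanceLowerBound ↔ NotInsulator)` via the
  real-variable lemma `lowerBound_of_superadditive_of_frequently` (Fekete iteration along residue
  classes: superadditive resistance + ONE good length scale in every tail ⇒ `D_n ≥ 1/(2(2/c+3|C|+1))`
  for EVERY `n ≥ 2`).  Consequence for both sides: given the route's bet (A) and fixed-`N`
  positivity (P), proving (C) needs a lower bound only along SOME subsequence of lengths (dyadic,
  say), and disproving (C) needs `D_N → 0` along ALL lengths.
* §5 DICHOTOMY (new): `insulator_or_lowerBound : SuperadditiveResistance → PositiveConductance →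
  (… → Tendsto D atTop (𝓝 0) ∨ LowerBound D)` — under (A)+(P) the only way (C) fails is a
  PERFECT INSULATOR (`D_N → 0`), the sharpest form of the kill criterion.
* §6 ENGINES (docstring `engines`): of the planner's three candidate engines, fluctuation /
  uncertainty relations (TUR, KUR) bound currents from ABOVE only; `N`-uniform spectral-gap /
  hypocoercive lower bounds are blocked by the catalogued barrier `SpectralGapClosing`
  (gap `~ N⁻³`, proved matrix inequality in tree); the noisy-chain comparison needs a transfer
  uniform in vanishing noise, which no printed bound provides.  Surviving engines: the SUBadditive
  series law (generation-1 `Reduction.lean`: `QuasiSubadditiveResistance → PositiveConductance →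
  crux`), monotone conductance `D_{N+1} ≥ D_N` (numerically probed, §8), and §4's
  one-good-scale-per-tail form under (A).
* §7 LITERATURE (docstring `literature`): why no insulator is expected (De Roeck–Huveneers).
* §8 NUMERICS (docstring `numerics`): kit jobs j006876 (D_N, N = 2…64, pinnedChain 1 1 1 1, T = 1)
  and j006878 (small-N monotonicity hunt over 9 regimes); results auto-attach to the item.

Generation-1 material NOT re-derived here (attached to the item as evidence by
refuter-cdisprove-…-11749-0, files `Disproof.lean` v1.2, `LoadBearing.lean`, `SequenceLevel.lean`,
`Reduction.lean`, `Harmonic.lean`, `Evidence.lean`): the harmonic-corner lower bound, the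
`D_N = 1/N` superadditive witness (`(C)` independent of (A)+(B)+(P)+bounded), the scaling
reductions `crux_iff_unit_temperature` / `crux_iff_unit_pinning`, `lowerBound_of_monotone`,
`lowerBound_of_quasiSubadditive`.  This seat could not read those files (evidence store not mounted
in its jail) and worked from their ledger notes; nothing below contradicts them.
-/

noncomputable section

open MeasureTheory Filter Topology
open Literature.MathematicalPhysics.KineticTheory.HeatConduction
open Summit.AtomisticToContinuum.FouriersLaw.Theses.JunctionLocality
  (ConductanceLowerBound SuperadditiveResistance PositiveConductance NessUnique NonBallistic)

namespace Summit.AtomisticToContinuum.FouriersLaw.Cruxes.ConductanceLowerBound.Disproof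

/-! ## §0 Read-back of the crux in named pieces -/

/-- The weak-NESS uniqueness antecedent of the crux at parameters `(ω₂, lam, β, γ)`
(= the body of the support item `NessUnique` at these parameters). -/
def UniqAt (ω₂ lam β γ : ℝ) : Prop :=
  ∀ (N : ℕ) (T_L T_R : ℝ), 0 < T_L → 0 < T_R → ∀ μ ν : Measure (PhaseSpace N),
    (pinnedChain ω₂ lam β γ).IsSteadyState N T_L T_R μ →
    (pinnedChain ω₂ lam β γ).IsSteadyState N T_L T_R ν → μ = ν

/-- `μ` is a family of weak steady states of `pinnedChain ω₂ lam β γ` (constrained at positive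
bath temperatures only). -/
def IsSteadyFamily (ω₂ lam β γ : ℝ) (μ : (N : ℕ) → ℝ → ℝ → Measure (PhaseSpace N)) : Prop :=
  ∀ (N : ℕ) (T_L T_R : ℝ), 0 < T_L → 0 < T_R →
    (pinnedChain ω₂ lam β γ).IsSteadyState N T_L T_R (μ N T_L T_R)

/-- `D` is the sequence of finite-`N` linear-response coefficients of the family `μ` at `T`
(BLR's inner limit `δT → 0`, `δ ≠ 0`). -/
def IsResponse (ω₂ lam β γ : ℝ) (μ : (N : ℕ) → ℝ → ℝ → Measure (PhaseSpace N)) (T : ℝ)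
    (D : ℕ → ℝ) : Prop :=
  ∀ N : ℕ, Tendsto (fun δ : ℝ =>
    (pinnedChain ω₂ lam β γ).totalCurrent (μ N (T + δ / 2) (T - δ / 2)) / δ) (𝓝[≠] 0) (𝓝 (D N))

/-- The crux's conclusion on a response sequence: `liminf_N D_N > 0`. -/
def LowerBound (D : ℕ → ℝ) : Prop := ∃ c : ℝ, 0 < c ∧ ∃ N₁ : ℕ, ∀ N : ℕ, N₁ ≤ N → c ≤ D N

/-- The weaker conclusion `limsup_N D_N > 0`: NOT a perfect insulator. -/
def NotInsulatorSeq (D : ℕ → ℝ) : Prop := ∃ c : ℝ, 0 < c ∧ ∀ N₀ : ℕ, ∃ N : ℕ, N₀ ≤ N ∧ c ≤ D N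

/-- **Read-back.** The route decl, verbatim, in the named pieces above. -/
theorem crux_iff :
    ConductanceLowerBound ↔
      ∀ ω₂ lam β γ : ℝ, 0 < ω₂ → 0 < lam → 0 < β → 0 < γ → UniqAt ω₂ lam β γ →
        ∀ μ : (N : ℕ) → ℝ → ℝ → Measure (PhaseSpace N), IsSteadyFamily ω₂ lam β γ μ →
          ∀ T : ℝ, 0 < T → ∀ D : ℕ → ℝ, IsResponse ω₂ lam β γ μ T D → LowerBound D :=
  Iff.rfl

/-- `LowerBound D → NotInsulatorSeq D` (eventually ⇒ frequently). -/
theorem notInsulatorSeq_of_lowerBound {D : ℕ → ℝ} (h : LowerBound D) : NotInsulatorSeq D := by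
  obtain ⟨c, hc, N₁, hN₁⟩ := h
  exact ⟨c, hc, fun N₀ => ⟨max N₀ N₁, le_max_left _ _, hN₁ _ (le_max_right _ _)⟩⟩

/-! ## §1 The crux is a corollary of the conjunct -/

/-- **`FouriersLaw → ConductanceLowerBound`.** Clause (ii) of `FouriersLawFor` gives, along every
steady-state family, response coefficients converging to `κ(T) > 0`; the crux's `D` is that
sequence (limits along `𝓝[≠] 0` are unique), so `D_N ≥ κ(T)/2` eventually.  The uniqueness
antecedent is not even used.  Hence the crux is refutable only by refuting the conjunct. -/
theorem of_fouriersLaw (h : _root_.FouriersLaw) : ConductanceLowerBound := by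
  intro ω₂ lam β γ hω hl hβ hγ _ μ hμ T hT D hD
  obtain ⟨-, κ, hκpos, hκ⟩ := h ω₂ lam β γ hω hl hβ hγ
  obtain ⟨D', hD', hlim⟩ := hκ μ hμ T hT
  have hDD' : D = D' := funext fun N => tendsto_nhds_unique (hD N) (hD' N)
  subst hDD'
  have hκT : 0 < κ T := hκpos T hT
  have hev : ∀ᶠ N in atTop, κ T / 2 < D N := hlim.eventually_const_lt (by linarith)
  obtain ⟨N₁, hN₁⟩ := eventually_atTop.mp hev
  exact ⟨κ T / 2, by linarith, N₁, fun N hN => (hN₁ N hN).le⟩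

/-! ## §2 Load-bearing analysis (each conditional on the support item `NessUnique`)

Every `_false_without_` theorem below must discharge the uniqueness antecedent `UniqAt`, which is
the route's own open support item `NessUnique` (stmt-AtomisticToContinuum-0741); they are therefore
stated as `NessUnique → ¬ …`.  This is also WHY NO UNCONDITIONAL LEAN REFUTATION OF THE CRUX CAN
EXIST before `NessUnique` lands: `¬crux` unfolds to `∃ params, UniqAt params ∧ …`. -/

/-- The crux WITHOUT the steady-state constraint on the family `μ`. -/
def WithoutSteadyFamily : Prop :=
  ∀ ω₂ lam β γ : ℝ, 0 < ω₂ → 0 < lam → 0 < β → 0 < γ → UniqAt ω₂ lam β γ →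
    ∀ μ : (N : ℕ) → ℝ → ℝ → Measure (PhaseSpace N),
      ∀ T : ℝ, 0 < T → ∀ D : ℕ → ℝ, IsResponse ω₂ lam β γ μ T D → LowerBound D

/-- The crux WITHOUT the response hypothesis tying `D` to `μ`. -/
def WithoutResponse : Prop :=
  ∀ ω₂ lam β γ : ℝ, 0 < ω₂ → 0 < lam → 0 < β → 0 < γ → UniqAt ω₂ lam β γ →
    ∀ μ : (N : ℕ) → ℝ → ℝ → Measure (PhaseSpace N), IsSteadyFamily ω₂ lam β γ μ →
      ∀ T : ℝ, 0 < T → ∀ D : ℕ → ℝ, LowerBound D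

/-- The crux WITHOUT `0 < T`. -/
def WithoutPosTemp : Prop :=
  ∀ ω₂ lam β γ : ℝ, 0 < ω₂ → 0 < lam → 0 < β → 0 < γ → UniqAt ω₂ lam β γ →
    ∀ μ : (N : ℕ) → ℝ → ℝ → Measure (PhaseSpace N), IsSteadyFamily ω₂ lam β γ μ →
      ∀ T : ℝ, ∀ D : ℕ → ℝ, IsResponse ω₂ lam β γ μ T D → LowerBound D

/-- The zero sequence has no positive lower bound. -/
theorem not_lowerBound_zero : ¬ LowerBound (fun _ => 0) := by
  rintro ⟨c, hc, N₁, hN₁⟩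
  have := hN₁ N₁ le_rfl
  linarith

/-- The zero measure family has the zero response at every `T`. -/
theorem isResponse_zero (ω₂ lam β γ T : ℝ) :
    IsResponse ω₂ lam β γ (fun _ _ _ => 0) T (fun _ => 0) := by
  intro N
  simp only [OscillatorChain.totalCurrent, integral_zero_measure, Finset.sum_const_zero, zero_div]
  exact tendsto_const_nhds

/-- **Any proof must use that `μ` is a steady-state family**: without it the zero family (no
mass, no current) has response `D ≡ 0`. -/
theorem false_without_steadyFamily (hU : NessUnique) : ¬ WithoutSteadyFamily := fun h =>
  not_lowerBound_zero (h 1 1 1 1 one_pos one_pos one_pos one_pos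
    (hU 1 1 1 1 one_pos one_pos one_pos one_pos) (fun _ _ _ => 0) 1 one_pos (fun _ => 0)
    (isResponse_zero 1 1 1 1 1))

/-- The canonical steady-state family of `pinnedChain 1 1 1 1`: the CEHR 2018 steady state
(proved fact `pinnedChain_exists_isSteadyState`) at positive bath temperatures, the zero measure
(junk) elsewhere. -/
def canonicalFamily : (N : ℕ) → ℝ → ℝ → Measure (PhaseSpace N) := fun N a b =>
  if h : 0 < a ∧ 0 < b then
    Classical.choose (pinnedChain_exists_isSteadyState (ω₂ := 1) (lam := 1) (β := 1) (γ := 1)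
      one_pos one_pos one_pos one_pos N h.1 h.2)
  else 0

theorem isSteadyFamily_canonicalFamily : IsSteadyFamily 1 1 1 1 canonicalFamily := by
  intro N T_L T_R hL hR
  simp only [canonicalFamily, dif_pos (And.intro hL hR)]
  exact Classical.choose_spec (pinnedChain_exists_isSteadyState (ω₂ := 1) (lam := 1) (β := 1)
    (γ := 1) one_pos one_pos one_pos one_pos N hL hR)

theorem canonicalFamily_of_not {N : ℕ} {a b : ℝ} (h : ¬ (0 < a ∧ 0 < b)) :
    canonicalFamily N a b = 0 := by
  simp only [canonicalFamily, dif_neg h]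

/-- **Any proof must use the response hypothesis**: without it `D` is a free variable
(take `D ≡ 0` along the canonical family). -/
theorem false_without_response (hU : NessUnique) : ¬ WithoutResponse := fun h =>
  not_lowerBound_zero (h 1 1 1 1 one_pos one_pos one_pos one_pos
    (hU 1 1 1 1 one_pos one_pos one_pos one_pos) canonicalFamily isSteadyFamily_canonicalFamily
    1 one_pos (fun _ => 0))

/-- At `T = 0` the response hypothesis only sees the family at temperature pairs `(δ/2, -δ/2)`,
where it is unconstrained: along the canonical family the response at `T = 0` is `0`. -/
theorem isResponse_canonicalFamily_zero : IsResponse 1 1 1 1 canonicalFamily 0 (fun _ => 0) := by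
  intro N
  have hneg : ∀ δ : ℝ, ¬ (0 < 0 + δ / 2 ∧ 0 < 0 - δ / 2) := by
    rintro δ ⟨h1, h2⟩
    linarith
  have hfun : (fun δ : ℝ => (pinnedChain 1 1 1 1).totalCurrent
      (canonicalFamily N (0 + δ / 2) (0 - δ / 2)) / δ) = fun _ => 0 := by
    funext δ
    rw [canonicalFamily_of_not (hneg δ)]
    simp [OscillatorChain.totalCurrent]
  rw [hfun]
  exact tendsto_const_nhds

/-- **Any proof must use `0 < T`**: at `T = 0` the canonical family has response `0`. -/
theorem false_without_posTemp (hU : NessUnique) : ¬ WithoutPosTemp := fun h =>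
  not_lowerBound_zero (h 1 1 1 1 one_pos one_pos one_pos one_pos
    (hU 1 1 1 1 one_pos one_pos one_pos one_pos) canonicalFamily isSteadyFamily_canonicalFamily
    0 (fun _ => 0) isResponse_canonicalFamily_zero)

/-- The crux WITHOUT the weak-NESS uniqueness antecedent (all other hypotheses kept). -/
def WithoutUniqueness : Prop :=
  ∀ ω₂ lam β γ : ℝ, 0 < ω₂ → 0 < lam → 0 < β → 0 < γ →
    ∀ μ : (N : ℕ) → ℝ → ℝ → Measure (PhaseSpace N), IsSteadyFamily ω₂ lam β γ μ →
      ∀ T : ℝ, 0 < T → ∀ D : ℕ → ℝ, IsResponse ω₂ lam β γ μ T D → LowerBound D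

/-- **Dropping the uniqueness antecedent ALONE cannot be refuted either**: the resulting
(stronger) statement is still a corollary of the conjunct, because clause (ii) of
`FouriersLawFor` is itself stated for EVERY steady-state family.  So `WithoutUniqueness` is
sandwiched `FouriersLaw → WithoutUniqueness → ConductanceLowerBound`; the antecedent is in the
crux for the glue's convenience (it makes `D` canonical), not for truth.  Contrast §3: dropping
uniqueness AND `0 < γ` is refuted. -/
theorem of_fouriersLaw_withoutUniqueness (h : _root_.FouriersLaw) : WithoutUniqueness := by
  intro ω₂ lam β γ hω hl hβ hγ μ hμ T hT D hD
  obtain ⟨-, κ, hκpos, hκ⟩ := h ω₂ lam β γ hω hl hβ hγ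
  obtain ⟨D', hD', hlim⟩ := hκ μ hμ T hT
  have hDD' : D = D' := funext fun N => tendsto_nhds_unique (hD N) (hD' N)
  subst hDD'
  have hκT : 0 < κ T := hκpos T hT
  have hev : ∀ᶠ N in atTop, κ T / 2 < D N := hlim.eventually_const_lt (by linarith)
  obtain ⟨N₁, hN₁⟩ := eventually_atTop.mp hev
  exact ⟨κ T / 2, by linarith, N₁, fun N hN => (hN₁ N hN).le⟩

/-- `WithoutUniqueness → ConductanceLowerBound` (weakening by an extra antecedent). -/
theorem crux_of_withoutUniqueness (h : WithoutUniqueness) : ConductanceLowerBound :=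
  fun ω₂ lam β γ hω hl hβ hγ _ μ hμ T hT D hD => h ω₂ lam β γ hω hl hβ hγ μ hμ T hT D hD

/-! ## §2b NOT load-bearing: `0 < lam`, `0 < β` — the harmonic corner satisfies the LOWER bound

At `lam = β = 0` (pinned HARMONIC chain, outside the crux's range but with the same conventions)
the conclusion of the crux HOLDS along the proved Gaussian steady-state family, indeed with
`D_N → +∞` (ballistic): `D_{M+1} = M c_{M+1}`, `c_N → c_∞ > 0`
(`HarmonicChainBallisticFlux_holds`, Rieder–Lebowitz–Lieb / Nakazawa / Roy–Dhar).  So the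
anharmonic couplings are NOT what makes (C) true — they are the obstacle (they are what makes the
UPPER half / NonBallistic true); a proof of (C) "by comparison with the harmonic chain" would need
a monotonicity-in-anharmonicity principle, which is not available (no sign principle for the
NESS current).  Orientation check: `D ≥ 0` is the physical sign of the tree's `bondCurrent`
with `T_L` at site `0`. -/

/-- **Harmonic corner: (C) holds and (B) fails.**  For `pinnedChain ω₂ 0 0 γ` (`ω₂, γ > 0`)
there is a steady-state family along which, at every `T > 0`, the response coefficients exist,
satisfy the crux's `LowerBound`, and tend to `+∞`. -/
theorem harmonic_corner {ω₂ γ : ℝ} (hω : 0 < ω₂) (hγ : 0 < γ) :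
    ∃ μ : (N : ℕ) → ℝ → ℝ → Measure (PhaseSpace N), IsSteadyFamily ω₂ 0 0 γ μ ∧
      ∀ T : ℝ, 0 < T → ∃ D : ℕ → ℝ,
        IsResponse ω₂ 0 0 γ μ T D ∧ LowerBound D ∧ Tendsto D atTop atTop := by
  obtain ⟨μ, hμ, c, cinf, -, hresp, -, hdiv⟩ :=
    Literature.Barriers.AtomisticToContinuum.HarmonicChainBallisticFlux_holds.ballisticLaw hω hγ
  refine ⟨μ, hμ, fun T hT => ?_⟩
  -- D_N := (N - 1) c_N, i.e. D_{M+1} = M c_{M+1} and D_0 = 0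
  set D : ℕ → ℝ := fun N => ((N - 1 : ℕ) : ℝ) * c N with hD
  have hDg : D = (fun M : ℕ => (M : ℝ) * c (M + 1)) ∘ fun N : ℕ => N - 1 := by
    funext N
    cases N with
    | zero => simp [hD]
    | succ M => simp [hD]
  have hDdiv : Tendsto D atTop atTop := by
    rw [hDg]
    exact hdiv.comp (tendsto_sub_atTop_nat 1)
  refine ⟨D, fun N => ?_, ?_, hDdiv⟩
  · cases N with
    | zero =>
      simp only [OscillatorChain.totalCurrent_zero, zero_div, hD]
      simp
    | succ M =>
      have e : D (M + 1) = (M : ℝ) * c (M + 1) := by simp [hD]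
      rw [e]
      exact hresp T hT M
  · obtain ⟨N₁, hN₁⟩ := eventually_atTop.mp (hDdiv.eventually_ge_atTop 1)
    exact ⟨1, one_pos, N₁, hN₁⟩

/-- Hence the variant of the crux with `0 < lam`, `0 < β` weakened to `0 ≤ lam`, `0 ≤ β` is NOT
refuted by the harmonic member along its Gaussian family (it satisfies the conclusion); and the
pair "(C) true, (B) `NonBallistic` false" is realised, so (C) carries no finiteness information. -/
theorem harmonic_corner_lowerBound_not_nonBallistic {ω₂ γ : ℝ} (hω : 0 < ω₂) (hγ : 0 < γ) :
    ∃ μ : (N : ℕ) → ℝ → ℝ → Measure (PhaseSpace N), IsSteadyFamily ω₂ 0 0 γ μ ∧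
      ∀ T : ℝ, 0 < T → ∃ D : ℕ → ℝ, IsResponse ω₂ 0 0 γ μ T D ∧ LowerBound D ∧
        ¬ (∀ ε : ℝ, 0 < ε → ∀ N₀ : ℕ, ∃ N : ℕ, N₀ ≤ N ∧ D N ≤ ε * ((N : ℝ) - 1)) := by
  obtain ⟨μ, hμ, c, cinf, hcinf, hresp, hrate, hdiv⟩ :=
    Literature.Barriers.AtomisticToContinuum.HarmonicChainBallisticFlux_holds.ballisticLaw hω hγ
  refine ⟨μ, hμ, fun T hT => ?_⟩
  set D : ℕ → ℝ := fun N => ((N - 1 : ℕ) : ℝ) * c N with hD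
  have hDg : D = (fun M : ℕ => (M : ℝ) * c (M + 1)) ∘ fun N : ℕ => N - 1 := by
    funext N
    cases N with
    | zero => simp [hD]
    | succ M => simp [hD]
  have hDdiv : Tendsto D atTop atTop := by
    rw [hDg]
    exact hdiv.comp (tendsto_sub_atTop_nat 1)
  refine ⟨D, fun N => ?_, ?_, ?_⟩
  · cases N with
    | zero =>
      simp only [OscillatorChain.totalCurrent_zero, zero_div, hD]
      simp
    | succ M =>
      have e : D (M + 1) = (M : ℝ) * c (M + 1) := by simp [hD]
      rw [e]
      exact hresp T hT M
  · obtain ⟨N₁, hN₁⟩ := eventually_atTop.mp (hDdiv.eventually_ge_atTop 1)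
    exact ⟨1, one_pos, N₁, hN₁⟩
  · -- the per-bond conductance D_{M+1}/M → c_∞ > 0 is eventually > c_∞/2, so D_N ≤ ε (N-1)
    -- fails for ε = c_∞/2 beyond some N₀
    intro hnb
    have hev : ∀ᶠ M : ℕ in atTop, cinf / 2 < (M : ℝ) * c (M + 1) / M :=
      hrate.eventually_const_lt (by linarith)
    obtain ⟨M₀, hM₀⟩ := eventually_atTop.mp hev
    obtain ⟨N, hN, hle⟩ := hnb (cinf / 2) (by linarith) (M₀ + 2)
    obtain ⟨M, rfl⟩ : ∃ M, N = M + 1 := ⟨N - 1, by omega⟩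
    have hM : M₀ ≤ M := by omega
    have hMpos : (0 : ℝ) < M := by exact_mod_cast (by omega : 0 < M)
    have h1 := hM₀ M hM
    have e : D (M + 1) = (M : ℝ) * c (M + 1) := by simp [hD]
    rw [e] at hle
    have e2 : ((M + 1 : ℕ) : ℝ) - 1 = M := by push_cast; ring
    rw [e2] at hle
    -- hle : M c_{M+1} ≤ (c_∞/2) M ; h1 : c_∞/2 < M c_{M+1} / M
    rw [lt_div_iff₀ hMpos] at h1
    linarith

/-! ## §3 The bath-free member `γ = 0`: non-uniqueness, and the role of `0 < γ`

LANDED: `Summits/AtomisticToContinuum/FouriersLaw/Theorems/ConductanceLowerBound/Negative/GammaZeroNonUniqueness.lean`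
(p69446, commit d06d72fe7c40; decls `Summit.AtomisticToContinuum.FouriersLaw.Theorems.pinnedChain_not_unique_gamma_zero`,
`…nessUnique_false_without_baths`, `…conductanceLowerBound_false_without_baths_or_uniqueness`, …) —
importable by planners / ideators.

New in generation 2 and UNCONDITIONAL.  With the baths switched off the weak steady-state class
is large: the Dirac mass at the mechanical equilibrium and every Gibbs measure `Z⁻¹e^{-H/T}`
(any `T > 0`) solve `∫ L f dμ = 0` for ALL nominal bath temperatures.  Consequences:
(i) `UniqAt ω₂ lam β 0` is FALSE, so the crux (which keeps uniqueness as an antecedent) is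
vacuously TRUE at `γ = 0` — the hypothesis `0 < γ` cannot be shown load-bearing by itself;
(ii) dropping BOTH the uniqueness antecedent and `0 < γ` makes the statement FALSE (the Dirac
family carries no current).  So positivity of the conductance enters only through the pair
(baths, uniqueness): a proof of (C) must use `γ > 0` in a way that also powers uniqueness
(hypoelliptic smoothing / irreducibility from the two thermostatted sites). -/

/-- The potential energy of `pinnedChain` is even in the configuration. -/
theorem potential_neg (ω₂ lam β γ : ℝ) (N : ℕ) (q : Fin N → ℝ) :
    (pinnedChain ω₂ lam β γ).potential N (-q) = (pinnedChain ω₂ lam β γ).potential N q := by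
  simp only [OscillatorChain.potential, pinnedChain, Pi.neg_apply]
  congr 1
  · exact Finset.sum_congr rfl fun i _ => by ring
  · refine Finset.sum_congr rfl fun i _ => Finset.sum_congr rfl fun j _ => ?_
    split_ifs <;> ring

theorem update_zero_neg {N : ℕ} (i : Fin N) (t : ℝ) :
    Function.update (0 : Fin N → ℝ) i (-t) = -Function.update (0 : Fin N → ℝ) i t := by
  funext k
  by_cases h : k = i
  · subst h; simp
  · simp [Function.update_of_ne h]

/-- At the mechanical equilibrium `(q, p) = (0, 0)` all forces vanish: `∂_{q_i} H (0) = 0`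
(the potential is even along every coordinate line through the origin; `deriv_comp_neg`). -/
theorem partialQ_hamiltonian_origin (ω₂ lam β γ : ℝ) {N : ℕ} (i : Fin N) :
    partialQ i ((pinnedChain ω₂ lam β γ).hamiltonian N) 0 = 0 := by
  rw [OscillatorChain.partialQ_hamiltonian_eq]
  change deriv (fun t => (pinnedChain ω₂ lam β γ).potential N
    (Function.update (0 : Fin N → ℝ) i t)) 0 = 0
  set g : ℝ → ℝ := fun t => (pinnedChain ω₂ lam β γ).potential N
    (Function.update (0 : Fin N → ℝ) i t) with hg
  have heven : (fun t => g (-t)) = g := by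
    funext t
    simp only [hg, update_zero_neg, potential_neg]
  have h : deriv (fun t => g (-t)) 0 = -deriv g (-0) := deriv_comp_neg g 0
  rw [heven, neg_zero] at h
  linarith

/-- With the baths switched off (`γ = 0`) the generator annihilates every observable at the
origin: `(L f)(0, 0) = 0`, whatever the nominal bath temperatures. -/
theorem generator_origin_gamma_zero (ω₂ lam β : ℝ) (N : ℕ) (T_L T_R : ℝ)
    (f : PhaseSpace N → ℝ) :
    (pinnedChain ω₂ lam β 0).generator N T_L T_R f 0 = 0 := by
  simp [OscillatorChain.generator, pinnedChain_γ, partialQ_hamiltonian_origin]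

/-- **`γ = 0`: the Dirac mass at the mechanical equilibrium is a weak steady state** for every
`N` and ALL nominal bath temperatures. -/
theorem isSteadyState_dirac_origin (ω₂ lam β : ℝ) (N : ℕ) (T_L T_R : ℝ) :
    (pinnedChain ω₂ lam β 0).IsSteadyState N T_L T_R (Measure.dirac 0) := by
  refine ⟨inferInstance, fun f _ _ => ?_, fun i => ?_⟩
  · rw [integral_dirac]
    exact generator_origin_gamma_zero ω₂ lam β N T_L T_R f
  · have h : (pinnedChain ω₂ lam β 0).bondCurrent N i =ᵐ[Measure.dirac (0 : PhaseSpace N)]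
        Function.const (PhaseSpace N) ((pinnedChain ω₂ lam β 0).bondCurrent N i 0) :=
      ae_eq_dirac _
    exact (integrable_const ((pinnedChain ω₂ lam β 0).bondCurrent N i 0)).congr h.symm

/-- The Dirac steady state carries no current (any parameters). -/
theorem totalCurrent_dirac_origin (ω₂ lam β γ : ℝ) (N : ℕ) :
    (pinnedChain ω₂ lam β γ).totalCurrent (Measure.dirac (0 : PhaseSpace N)) = 0 := by
  simp [OscillatorChain.totalCurrent, integral_dirac, OscillatorChain.bondCurrent]

/-- **`γ = 0`: the Gibbs measure at ANY temperature `T > 0` is a weak steady state for ALL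
nominal bath temperatures** (the bath terms of `∫ L f dμ_T` carry the factor `γ`;
`pinnedChain_integral_generator_gibbsMeasure`). -/
theorem isSteadyState_gibbs_gamma_zero {ω₂ lam β : ℝ} (hω : 0 < ω₂) (hl : 0 ≤ lam) (hβ : 0 ≤ β)
    (N : ℕ) {T : ℝ} (hT : 0 < T) (T_L T_R : ℝ) :
    (pinnedChain ω₂ lam β 0).IsSteadyState N T_L T_R ((pinnedChain ω₂ lam β 0).gibbsMeasure N T) := by
  refine ⟨pinnedChain_isProbabilityMeasure_gibbsMeasure hω hl hβ 0 N hT, fun f hf hfc => ?_,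
    fun i => ?_⟩
  · rw [pinnedChain_integral_generator_gibbsMeasure ω₂ lam β 0 N T T_L T_R (hf.of_le (by norm_cast))
      hfc]
    simp [pinnedChain_γ]
  · exact (pinnedChain ω₂ lam β 0).integrable_gibbsMeasure
      (pinnedChain_integrable_bondCurrent_mul_gibbsDensity hω hl hβ 0 N hT i)

/-- The Gibbs measure of a chain with at least one site does not charge the origin
(absolutely continuous w.r.t. Lebesgue measure). -/
theorem gibbsMeasure_origin (ω₂ lam β γ : ℝ) (N : ℕ) (T : ℝ) :
    (pinnedChain ω₂ lam β γ).gibbsMeasure (N + 1) T {0} = 0 := by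
  apply (pinnedChain ω₂ lam β γ).gibbsMeasure_absolutelyContinuous (N + 1) T
  have : NullSingletonClass (volume : Measure (PhaseSpace (N + 1))) := by
    change NullSingletonClass (Measure.prod volume volume)
    infer_instance
  exact measure_singleton 0

/-- **Weak-NESS uniqueness FAILS without baths.** At `γ = 0` (witness: `N = 1`,
`T_L = T_R = 1`) the Dirac mass at the origin and the Gibbs measure at `T = 1` are two distinct
weak steady states.  So at `γ = 0` the crux's antecedent `UniqAt` is false and the crux holds
there VACUOUSLY: `0 < γ` is load-bearing for the route only through `NessUnique`. -/
theorem not_uniqAt_gamma_zero {ω₂ lam β : ℝ} (hω : 0 < ω₂) (hl : 0 ≤ lam) (hβ : 0 ≤ β) :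
    ¬ UniqAt ω₂ lam β 0 := by
  intro h
  have key := h 1 1 1 one_pos one_pos _ _ (isSteadyState_dirac_origin ω₂ lam β 1 1 1)
    (isSteadyState_gibbs_gamma_zero hω hl hβ 1 one_pos 1 1)
  have h1 : (Measure.dirac (0 : PhaseSpace 1)) {0} = 1 := by simp
  rw [key, gibbsMeasure_origin ω₂ lam β 0 0 1] at h1
  exact zero_ne_one h1

/-- The crux with the uniqueness antecedent DROPPED and `0 < γ` WEAKENED to `0 ≤ γ`. -/
def WithoutBathsOrUniqueness : Prop :=
  ∀ ω₂ lam β γ : ℝ, 0 < ω₂ → 0 < lam → 0 < β → 0 ≤ γ →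
    ∀ μ : (N : ℕ) → ℝ → ℝ → Measure (PhaseSpace N), IsSteadyFamily ω₂ lam β γ μ →
      ∀ T : ℝ, 0 < T → ∀ D : ℕ → ℝ, IsResponse ω₂ lam β γ μ T D → LowerBound D

/-- **Unconditional refutation of the doubly-weakened variant**: at `γ = 0` the Dirac family is
a currentless steady-state family, response `D ≡ 0`.  ("No baths, no heat current.") -/
theorem false_without_baths_or_uniqueness : ¬ WithoutBathsOrUniqueness := by
  intro h
  have hresp : IsResponse 1 1 1 0 (fun N _ _ => Measure.dirac (0 : PhaseSpace N)) 1 (fun _ => 0) := by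
    intro N
    simp only [totalCurrent_dirac_origin, zero_div]
    exact tendsto_const_nhds
  exact not_lowerBound_zero (h 1 1 1 0 one_pos one_pos one_pos le_rfl
    (fun N _ _ => Measure.dirac 0) (fun N T_L T_R _ _ => isSteadyState_dirac_origin 1 1 1 N T_L T_R)
    1 one_pos (fun _ => 0) hresp)

/-! ## §4 Reduction of the crux to NON-INSULATION under the route's superadditivity bet (A)

New in generation 2.  Pure real analysis on the response sequence, then lifted verbatim into the
crux vocabulary.  The point for the PROVER: with (A) `SuperadditiveResistance` and (P)
`PositiveConductance` in hand, (C) follows from a positive lower bound `D_N ≥ c` holding for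
infinitely many `N` only (one good length scale in every tail — e.g. along `N = 2^k`).  The point
for the DISPROVER: compatible with (A), (C) can only fail through `D_N → 0` along ALL `N` (§5). -/

/-- Fekete iteration for a superadditive sequence on `{n ≥ 2}`:
`k · a_n + a_r ≤ a_{kn+r}` (`n, r ≥ 2`). -/
theorem iter_superadditive {a : ℕ → ℝ} (h : ∀ n m : ℕ, 2 ≤ n → 2 ≤ m → a n + a m ≤ a (n + m))
    {n r : ℕ} (hn : 2 ≤ n) (hr : 2 ≤ r) : ∀ k : ℕ, (k : ℝ) * a n + a r ≤ a (k * n + r)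
  | 0 => by simp
  | k + 1 => by
    have ih := iter_superadditive h hn hr k
    have hkr : 2 ≤ k * n + r := le_add_left hr
    have hstep := h (k * n + r) n hkr hn
    have e : (k + 1) * n + r = k * n + r + n := by ring
    rw [e]
    push_cast
    linarith

/-- **Superadditive resistance + a frequent lower bound ⇒ a GLOBAL lower bound.**  If `D_N > 0`
(`N ≥ 2`), the resistances `R_N = (N-1)/D_N` are superadditive up to the constant `C` on
`{N, M ≥ 2}`, and `D_N ≥ c > 0` for infinitely many `N`, then
`D_n ≥ 1/(2(2/c + 3|C| + 1))` for EVERY `n ≥ 2`.  Proof: `a_N := R_N - C` is superadditive;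
for `n ≥ 2` pick a good `N ≥ n + 2`, write `N = kn + r` (`2 ≤ r ≤ n+1`, `k ≥ 1`); then
`k a_n - |C| ≤ k a_n + a_r ≤ a_N ≤ (N-1)/c + |C|` and `N - 1 ≤ 2kn` give `a_n ≤ 2n/c + 2|C|`,
i.e. `R_n ≤ n(2/c + 3|C| + 1)`, i.e. `D_n ≥ (n-1)/(nK) ≥ 1/(2K)`. -/
theorem lowerBound_of_superadditive_of_frequently {D : ℕ → ℝ} {C c : ℝ} (hc : 0 < c)
    (hpos : ∀ N : ℕ, 2 ≤ N → 0 < D N)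
    (hsup : ∀ N M : ℕ, 2 ≤ N → 2 ≤ M →
      ((N : ℝ) - 1) / D N + ((M : ℝ) - 1) / D M - C ≤ ((N : ℝ) + (M : ℝ) - 1) / D (N + M))
    (hfreq : ∀ N₀ : ℕ, ∃ N : ℕ, N₀ ≤ N ∧ c ≤ D N) :
    ∀ n : ℕ, 2 ≤ n → 1 / (2 * (2 / c + 3 * |C| + 1)) ≤ D n := by
  -- the shifted resistance `a_N = R_N - C` is superadditive on `{N ≥ 2}`
  set a : ℕ → ℝ := fun N => ((N : ℝ) - 1) / D N - C with ha
  have hsa : ∀ n m : ℕ, 2 ≤ n → 2 ≤ m → a n + a m ≤ a (n + m) := by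
    intro n m hn hm
    have := hsup n m hn hm
    simp only [ha]
    push_cast
    linarith
  intro n hn
  have hn0 : (0 : ℝ) < n := by exact_mod_cast (by omega : 0 < n)
  obtain ⟨N, hN, hcN⟩ := hfreq (n + 2)
  -- Euclidean division: N = k n + r with 2 ≤ r ≤ n + 1 and k ≥ 1
  set k : ℕ := (N - 2) / n with hk
  set r : ℕ := 2 + (N - 2) % n with hr
  have hdiv : n * ((N - 2) / n) + (N - 2) % n = N - 2 := Nat.div_add_mod (N - 2) n
  have hNkr : N = k * n + r := by
    rw [hk, hr]
    have : 2 ≤ N := by omega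
    have := hdiv
    rw [Nat.mul_comm] at this
    omega
  have hr2 : 2 ≤ r := by omega
  have hrn : r ≤ n + 1 := by
    have := Nat.mod_lt (N - 2) (by omega : 0 < n)
    omega
  have hk1 : 1 ≤ k := by
    rw [hk]
    exact (Nat.le_div_iff_mul_le (by omega)).mpr (by simpa using (by omega : n ≤ N - 2))
  have hDN : 0 < D N := hpos N (by omega)
  have hDr : 0 < D r := hpos r hr2
  have hDn : 0 < D n := hpos n hn
  -- bounds on a_N and a_r
  have haN : a N ≤ ((N : ℝ) - 1) / c + |C| := by
    simp only [ha]
    have h1 : ((N : ℝ) - 1) / D N ≤ ((N : ℝ) - 1) / c :=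
      div_le_div_of_nonneg_left (by
        have : (1 : ℝ) ≤ N := by exact_mod_cast (by omega : 1 ≤ N)
        linarith) hc hcN
    have h2 : -C ≤ |C| := neg_le_abs C
    linarith
  have har : -|C| ≤ a r := by
    simp only [ha]
    have h1 : 0 ≤ ((r : ℝ) - 1) / D r :=
      div_nonneg (by
        have : (2 : ℝ) ≤ r := by exact_mod_cast hr2
        linarith) hDr.le
    have h2 : C ≤ |C| := le_abs_self C
    linarith
  -- Fekete iteration
  have hiter := iter_superadditive hsa hn hr2 k
  rw [← hNkr] at hiter
  have hk1' : (1 : ℝ) ≤ k := by exact_mod_cast hk1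
  have hkpos : (0 : ℝ) < k := by linarith
  have hkan : (k : ℝ) * a n ≤ ((N : ℝ) - 1) / c + 2 * |C| := by linarith
  have hN1 : (N : ℝ) - 1 ≤ 2 * k * n := by
    have h1 : (N : ℝ) = k * n + r := by rw [hNkr]; push_cast; ring
    have h2 : (r : ℝ) ≤ n + 1 := by exact_mod_cast hrn
    nlinarith
  have han : a n ≤ 2 * n / c + 2 * |C| := by
    have h1 : (k : ℝ) * a n ≤ 2 * k * n / c + 2 * |C| := by
      have : ((N : ℝ) - 1) / c ≤ 2 * k * n / c := div_le_div_of_nonneg_right hN1 hc.le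
      linarith
    have h2 : (k : ℝ) * a n ≤ k * (2 * n / c + 2 * |C|) := by
      have : 2 * (k : ℝ) * n / c + 2 * |C| ≤ k * (2 * n / c + 2 * |C|) := by
        have habs : 0 ≤ |C| := abs_nonneg C
        have : 2 * |C| ≤ k * (2 * |C|) := by nlinarith
        have e : (k : ℝ) * (2 * n / c + 2 * |C|) = 2 * k * n / c + k * (2 * |C|) := by ring
        linarith
      linarith
    exact le_of_mul_le_mul_left h2 hkpos
  have hRn : ((n : ℝ) - 1) / D n ≤ n * (2 / c + 3 * |C| + 1) := by
    have h1 : ((n : ℝ) - 1) / D n = a n + C := by simp only [ha]; ring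
    have h2 : C ≤ |C| := le_abs_self C
    have habs : 0 ≤ |C| := abs_nonneg C
    have hn1 : (1 : ℝ) ≤ n := by exact_mod_cast (by omega : 1 ≤ n)
    have e1 : 2 * (n : ℝ) / c = n * (2 / c) := by ring
    have e2 : 3 * |C| ≤ n * (3 * |C|) := by nlinarith
    rw [h1]
    nlinarith
  have hK : 0 < 2 / c + 3 * |C| + 1 := by positivity
  have hn1 : (1 : ℝ) ≤ (n : ℝ) - 1 := by
    have : (2 : ℝ) ≤ n := by exact_mod_cast hn
    linarith
  have h3 : (n : ℝ) - 1 ≤ n * (2 / c + 3 * |C| + 1) * D n := by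
    have := (div_le_iff₀ hDn).mp hRn
    linarith
  rw [div_le_iff₀ (by positivity)]
  nlinarith

/-- Sequence-level form: superadditivity + positivity + `NotInsulatorSeq ⇒ LowerBound`. -/
theorem lowerBound_of_superadditive_of_notInsulatorSeq {D : ℕ → ℝ} {C : ℝ}
    (hpos : ∀ N : ℕ, 2 ≤ N → 0 < D N)
    (hsup : ∀ N M : ℕ, 2 ≤ N → 2 ≤ M →
      ((N : ℝ) - 1) / D N + ((M : ℝ) - 1) / D M - C ≤ ((N : ℝ) + (M : ℝ) - 1) / D (N + M))
    (hni : NotInsulatorSeq D) : LowerBound D := by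
  obtain ⟨c, hc, hfreq⟩ := hni
  exact ⟨_, by positivity, 2, lowerBound_of_superadditive_of_frequently hc hpos hsup hfreq⟩

/-- **NOT AN INSULATOR**: the crux with its conclusion weakened from `liminf_N D_N > 0` to
`limsup_N D_N > 0` (`∃ c > 0`, `D_N ≥ c` for infinitely many `N`).  This is the irreducible
content of item 11749 in every route that wants it (in StaticAbelianSqueeze convergence of `D_N`
comes from the squeeze, in JunctionLocality from (A) via Fekete; either way only the SIGN of the
limit is asked of this item). -/
def NotInsulator : Prop :=
  ∀ ω₂ lam β γ : ℝ, 0 < ω₂ → 0 < lam → 0 < β → 0 < γ → UniqAt ω₂ lam β γ →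
    ∀ μ : (N : ℕ) → ℝ → ℝ → Measure (PhaseSpace N), IsSteadyFamily ω₂ lam β γ μ →
      ∀ T : ℝ, 0 < T → ∀ D : ℕ → ℝ, IsResponse ω₂ lam β γ μ T D → NotInsulatorSeq D

/-- The crux implies non-insulation (trivially). -/
theorem notInsulator_of_crux (h : ConductanceLowerBound) : NotInsulator :=
  fun ω₂ lam β γ hω hl hβ hγ hu μ hμ T hT D hD =>
    notInsulatorSeq_of_lowerBound (h ω₂ lam β γ hω hl hβ hγ hu μ hμ T hT D hD)

/-- **Under (A) and (P), non-insulation implies the crux.** -/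
theorem crux_of_notInsulator (hA : SuperadditiveResistance) (hP : PositiveConductance)
    (h : NotInsulator) : ConductanceLowerBound := by
  intro ω₂ lam β γ hω hl hβ hγ hu μ hμ T hT D hD
  have hpos : ∀ N : ℕ, 2 ≤ N → 0 < D N := hP ω₂ lam β γ hω hl hβ hγ hu μ hμ T hT D hD
  obtain ⟨C, hsup⟩ := hA ω₂ lam β γ hω hl hβ hγ hu μ hμ T hT D hD hpos
  exact lowerBound_of_superadditive_of_notInsulatorSeq hpos hsup
    (h ω₂ lam β γ hω hl hβ hγ hu μ hμ T hT D hD)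

/-- **Given the route's (A) and (P), the crux IS non-insulation.**  So (C) resists exactly as
strongly as "the clean pinned anharmonic chain is not a perfect insulator along every
subsequence of lengths"; and a prover holding (A) may establish (C) on any convenient
subsequence of lengths. -/
theorem crux_iff_notInsulator (hA : SuperadditiveResistance) (hP : PositiveConductance) :
    ConductanceLowerBound ↔ NotInsulator :=
  ⟨notInsulator_of_crux, crux_of_notInsulator hA hP⟩

/-! ## §5 Dichotomy under (A): perfect insulator, or the crux -/

/-- Sequence level: positivity + superadditive resistance ⇒ EITHER `D_N → 0` OR `LowerBound D`. -/
theorem insulator_or_lowerBound_seq {D : ℕ → ℝ} {C : ℝ}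
    (hpos : ∀ N : ℕ, 2 ≤ N → 0 < D N)
    (hsup : ∀ N M : ℕ, 2 ≤ N → 2 ≤ M →
      ((N : ℝ) - 1) / D N + ((M : ℝ) - 1) / D M - C ≤ ((N : ℝ) + (M : ℝ) - 1) / D (N + M)) :
    Tendsto D atTop (𝓝 0) ∨ LowerBound D := by
  by_cases h : ∃ c : ℝ, 0 < c ∧ ∀ N₀ : ℕ, ∃ N : ℕ, N₀ ≤ N ∧ c ≤ D N
  · exact Or.inr (lowerBound_of_superadditive_of_notInsulatorSeq hpos hsup h)
  · left
    push Not at h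
    rw [Metric.tendsto_atTop]
    intro ε hε
    obtain ⟨N₀, hN₀⟩ := h ε hε
    refine ⟨max N₀ 2, fun N hN => ?_⟩
    have h1 : D N < ε := hN₀ N (le_of_max_le_left hN)
    have h2 : 0 < D N := hpos N (le_of_max_le_right hN)
    rw [Real.dist_eq, sub_zero, abs_of_pos h2]
    exact h1

/-- **KILL CRITERION, sharp form.**  Under the route's (A) `SuperadditiveResistance` and (P)
`PositiveConductance`, at every admissible parameter point the response sequence EITHER tends
to `0` (the chain is a perfect thermal insulator at that `T`) OR satisfies the crux's lower bound.
A disproof of (C) compatible with (A) is therefore exactly an insulator construction — nothing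
weaker (anomalous sub-diffusion `D_N ~ N^{-α}` is such an insulator; oscillation in `N` with
`liminf D_N = 0 < limsup D_N` is EXCLUDED by (A)). -/
theorem insulator_or_lowerBound (hA : SuperadditiveResistance) (hP : PositiveConductance)
    {ω₂ lam β γ : ℝ} (hω : 0 < ω₂) (hl : 0 < lam) (hβ : 0 < β) (hγ : 0 < γ)
    (hu : UniqAt ω₂ lam β γ) {μ : (N : ℕ) → ℝ → ℝ → Measure (PhaseSpace N)}
    (hμ : IsSteadyFamily ω₂ lam β γ μ) {T : ℝ} (hT : 0 < T) {D : ℕ → ℝ}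
    (hD : IsResponse ω₂ lam β γ μ T D) :
    Tendsto D atTop (𝓝 0) ∨ LowerBound D := by
  have hpos : ∀ N : ℕ, 2 ≤ N → 0 < D N := hP ω₂ lam β γ hω hl hβ hγ hu μ hμ T hT D hD
  obtain ⟨C, hsup⟩ := hA ω₂ lam β γ hω hl hβ hγ hu μ hμ T hT D hD hpos
  exact insulator_or_lowerBound_seq hpos hsup

/-- The crux variant "no parameter point is a perfect insulator". -/
def NoPerfectInsulator : Prop :=
  ∀ ω₂ lam β γ : ℝ, 0 < ω₂ → 0 < lam → 0 < β → 0 < γ → UniqAt ω₂ lam β γ →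
    ∀ μ : (N : ℕ) → ℝ → ℝ → Measure (PhaseSpace N), IsSteadyFamily ω₂ lam β γ μ →
      ∀ T : ℝ, 0 < T → ∀ D : ℕ → ℝ, IsResponse ω₂ lam β γ μ T D → ¬ Tendsto D atTop (𝓝 0)

/-- **Under (A)+(P) the crux is equivalent to the absence of perfect insulators.** -/
theorem crux_iff_noPerfectInsulator (hA : SuperadditiveResistance) (hP : PositiveConductance) :
    ConductanceLowerBound ↔ NoPerfectInsulator := by
  constructor
  · intro h ω₂ lam β γ hω hl hβ hγ hu μ hμ T hT D hD hlim
    obtain ⟨c, hc, N₁, hN₁⟩ := h ω₂ lam β γ hω hl hβ hγ hu μ hμ T hT D hD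
    have hev : ∀ᶠ N in atTop, D N < c := hlim.eventually_lt_const hc
    obtain ⟨N₂, hN₂⟩ := eventually_atTop.mp hev
    have h1 := hN₁ (max N₁ N₂) (le_max_left _ _)
    have h2 := hN₂ (max N₁ N₂) (le_max_right _ _)
    linarith
  · intro h ω₂ lam β γ hω hl hβ hγ hu μ hμ T hT D hD
    rcases insulator_or_lowerBound hA hP hω hl hβ hγ hu hμ hT hD with hlim | hlb
    · exact absurd hlim (h ω₂ lam β γ hω hl hβ hγ hu μ hμ T hT D hD)
    · exact hlb

/-! ## §6 Engines — what can and cannot power a proof of (C) (docstring record) -/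

/-- **ENGINE ANALYSIS** (for provers; numbers, not adjectives).

The planner lists three candidate engines for (C).  Status after this seat's search:

1. *Linear-response fluctuation-theorem / uncertainty bounds.*  The thermodynamic uncertainty
   relation (Barato–Seifert 2015, doi:10.1103/physrevlett.114.158101; Gingrich–Horowitz–Perunov–
   England 2016, doi:10.1103/physrevlett.116.120601; finite-time form Pietzonka–Ritort–Seifert
   2017, doi:10.1103/physreve.96.012101 — located via `lit search --source crossref`, statements
   as commonly restated, pages not re-read this session) reads `⟨Q_t⟩² ≤ Var(Q_t)·Σ_t/(2k_B)`,
   and the kinetic uncertainty relation bounds `⟨Q_t⟩²/Var(Q_t)` by the dynamical activity: both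
   are UPPER bounds on the mean current given the noise.  In linear response
   (`Σ_t ≈ J δT t/T²`, `Var(Q_t) ≈ 2T²G t` by the equilibrium FDT) the TUR reads `J ≤ G δT`,
   i.e. it is saturated to first order in `δT` and yields no lower bound on `G = D_N/(N-1)`.
   For underdamped (Langevin-bath) dynamics the standard TUR can moreover fail and needs
   modification (Lee–Park–Park 2019, doi:10.1103/physreve.100.062132; Kwon–Lee 2022,
   doi:10.1088/1367-2630/ac2c8f).  ⇒ one-sided the wrong way: NOT an engine for (C).  (It is an
   engine for UPPER bounds — route BondHeatUncertainty.)
2. *Comparison with the energy-conserving-noise chain* (Bernardin–Olla 2005, Basile–Bernardin–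
   Olla 2009, Bernardin–Olla 2011 velocity flip): there `κ(λ_noise) ∈ (0, ∞)` is a theorem, but
   every printed LOWER bound is non-uniform as `λ_noise → 0` (variational lower bounds use test
   functions whose Dirichlet cost is paid to the noise), and `D_N` is not known to be monotone or
   continuous in `λ_noise` at `λ_noise = 0` uniformly in `N`.  ⇒ needs a NEW transfer statement;
   the natural one ("`D_N(λ) → D_N(0)` uniformly in `N`") is equivalent in difficulty to the
   conjunct's finiteness half.
3. *Multi-scale pigeonhole on the response temperature profile* (card anti-insulator-kink-
   rigidity): no printed ingredient; compatible with §4 (a bound on ONE good scale per tail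
   suffices under (A)).

Blocked engine (barrier reduction): any `N`-uniform spectral-gap / hypocoercivity constant.
`Literature.Barriers.AtomisticToContinuum.SpectralGapClosing` (Becker–Menegaki 2022 Thm 1,
Menegaki 2020 Prop 6.1, PROVED in tree as the trace inequality `inf Re σ(M) ≤ tr Γ/(2N)`): with
friction on two sites the gap is `O(1/N)` (harmonic: `Θ(N⁻³)`).  A lower bound of the shape
`D_N ≥ (gap_N)·(…bounded…)` therefore decays; (C) cannot come from relaxation RATES.

Surviving engines: (i) the SUBadditive series law `R_{N+M} ≤ R_N + R_M + C'` plus `D_2 > 0`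
(generation-1 `Reduction.lean`: `FeketeSeriesLaw.QuasiSubadditiveResistance → PositiveConductance
→ ConductanceLowerBound`, proved glue awaiting a prover); (ii) monotone conductance
`D_{N+1} ≥ D_N` (generation-1 `lowerBound_of_monotone`; true at the harmonic corner; probed
numerically in anharmonic regimes by job j006382, §8); (iii) §4 here: under (A), one good length
per tail.  None has a printed proof for a deterministic anharmonic chain
(`Literature.Barriers.AtomisticToContinuum.FixedLengthNoConductivityControl`: "Nothing is known
about the dependence of `D` on `L`", BLR 2000 §6.3). -/
theorem engines : True := trivial

/-! ## §7 Literature — why no insulator is expected (docstring record) -/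

/-- **LITERATURE NEGATIVES SEARCHED** (this seat + generation 1; `ledger negatives --problem
AtomisticToContinuum`: 6 entries, none in FouriersLaw).

* A kill needs a translation-invariant pinned anharmonic chain that is a PERFECT insulator at
  some `T > 0`.  De Roeck–Huveneers 2014/15 (CPAM 68, doi:10.1002/cpa.21550, asymptotic
  localization; catalogued as `Literature.Barriers.AtomisticToContinuum.AnticontinuumLocalization*`)
  prove only that the Green–Kubo conductivity is smaller than any power of the coupling /
  anharmonicity ratio in the atomic limit — `c(T)` may be tiny, never `0`; De Roeck–Huveneers,
  "Scenario for delocalization in translation-invariant systems" (PRB 90, 165137, 2014,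
  doi:10.1103/physrevb.90.165137): translation-invariant systems are argued NOT to be genuine
  insulators (mobile thermal bubbles restore transport); De Roeck–Huveneers 2019 review
  (arXiv:1904.07742) §3: the bad-transport class is pinning degree `a` > coupling degree `b`;
  `pinnedChain` has `a = b = 4`; §5: no translation-invariant classical chain is expected to be a
  genuine insulator.  The recent rigorous persistence-of-localization results (De Roeck–
  Huveneers–Prośniak 2025 CMP, doi:10.1007/s00220-025-05336-z; De Roeck–Huveneers–Meeus 2023,
  doi:10.1016/j.physa.2023.129245) are for DISORDERED chains and give long times, not `κ = 0`.
* Classical many-body localization without disorder is not believed to exist (Oganesyan–Pal–Huse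
  2009 classical spin chains conduct; Basko 2011 weak chaos in DNLS: transport by chaotic spots,
  arbitrarily slow but nonzero).  Disorder-induced insulation (Dhar–Lebowitz 2008 pinned
  disordered HARMONIC chain, `Literature.Barriers.AtomisticToContinuum.DisorderedHarmonicChain*`)
  needs disorder AND integrability; anharmonicity destroys it.
* Breather / strong-pinning obstructions (Hairer–Mattingly 2009,
  `Literature.Barriers.AtomisticToContinuum.StrongPinningBreathers`) concern pinning degree >
  coupling degree (`φ⁴`-type, condition C5 violated) and produce slow RELAXATION, not zero
  CURRENT; `pinnedChain` satisfies C5.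
* Numerics in print for pinned anharmonic chains (Aoki–Kusnezov 2000 `φ⁴`; Lepri–Livi–Politi 2003
  §6; BLR 2000 §10 item 1 "adding a 4-th order term to U(q) as well as to V(q)") uniformly report
  finite positive `κ` with `1/N` finite-size corrections and boundary jumps — the (C)-and-(A)
  consistent picture.

So the crux is the POSITIVITY half of an open problem whose expected answer is "true"; its
negation has no candidate mechanism.  Barrier entries consulted: AnticontinuumLocalization,
DisorderedHarmonicChain, FixedLengthNoConductivityControl, HarmonicCrystalBallistic,
LowTemperatureWeakAnharmonicity, MazurBoundBallistic, SpectralGapClosing, StrongPinningBreathers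
(all under `Literature/Barriers/AtomisticToContinuum/`). -/
theorem literature : True := trivial

/-! ## §8 Numerics (kit; results auto-attach to the item as evidence) -/

/-- **NUMERICAL PROBES** (nonequilibrium Langevin MD, BAOAB `dt = 0.01`, replicas for error bars;
script `nemd/main.py` in this seat's folder, bundled with each job):

* j006876 `nemd-scan-N` (supersedes cancelled j006378): `D_N = totalCurrent/δ` for `pinnedChain 1 1 1 1`, `T = 1`, baths
  `T ± 0.15` (`δ = 0.3`; `J` is odd in `δ`, so the relative bias is `O(δ²)`), `N = 2, 3, 4, 6, 8,
  12, 16, 24, 32, 48, 64`, 256 replicas × `t = 2·10⁴` each; plus a `δ = 0.15` linearity check at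
  `N = 4, 16`.  Purpose: the value of `c(1) ≈ κ(1)` the prover is bounding, and the shape of
  `R_N = (N-1)/D_N` (affine in `N` ⇔ two-sided junction locality (A)).
* j006878 `nemd-regimes` (supersedes cancelled j006382): `D_N`, `N = 2, …, 16`, in nine regimes — `(ω₂, lam, β, γ)` =
  (1,1,1,1), (1,5,5,1) [= `T = 5`], (1,25,25,1) [= `T = 25`], (1,0.2,0.2,1) [= `T = 0.2`],
  (9,1,1,1) [narrow band], (1,10,0.1,1) [pinning-dominated], (1,0.1,10,1) [coupling-dominated],
  (1,1,1,0.2), (1,1,1,5) [bath coupling] — hunting for NON-MONOTONICITY `D_{N+1} < D_N`, which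
  would kill the monotone-conductance engine as a universal principle (it cannot be refuted at
  the harmonic corner, where `D_N = (N-1)c_N` increases).

STATUS at this writing: queued (farm saturated: 1 node, ~2900 jobs ahead at higher priority).
Results land in `~/compute/<id>/outputs/summary.txt` and are summarised in the next revision of
this docstring; a liminf is not finitely refutable — these are calibration data for provers. -/
theorem numerics : True := trivial

/-! ## §9 Why it resists (summary for the lead) -/

/-- **WHY `ConductanceLowerBound` RESISTS** (generation 2, cycle 1):
(1) logically it is a corollary of the conjunct (`of_fouriersLaw`), so only a refutation of
Fourier's law for the clean pinned anharmonic chain refutes it; (2) every Lean refutation must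
first prove weak-NESS uniqueness (`NessUnique`, open item 0741) — the `¬` of the crux begins with
`∃ params, UniqAt params ∧ …`; (3) all junk/degenerate instances are absorbed (N = 0, 1 by `N₁`;
non-positive temperatures invisible to `𝓝[≠] 0`; the bath-free member `γ = 0` is vacuous because
uniqueness fails there, §3); (4) under the companion bet (A) the crux is exactly "no perfect
insulator" (§4–§5), and no insulating mechanism for a translation-invariant pinned anharmonic
chain at `T > 0` exists in print (§7); (5) natural strengthenings are either plausibly TRUE
(uniformity of `c` in `T` and in `γ`: bulk conductivity is expected to be contact-independent, and
heuristically `κ(T) → ∞` at both ends — `T → 0` is the harmonic limit (kinetic prediction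
`κ ~ (lam T)⁻²`, barrier LowTemperatureWeakAnharmonicity) and `T → ∞` is the doubly-quartic
homogeneous chain (amplitude scaling suggests growth like `T^{1/4}`; heuristic, unverified))
or physically false but not Lean-refutable without an upper-bound technology for `D_N`
(uniformity in `ω₂`: narrow-band limit).  Next regimes for a future cycle: (a) the
`NessUnique`-free direction — look for a second weak solution of `L*μ = 0` with integrable
currents at `γ > 0` (would make the crux VACUOUSLY true and sink clause (i) of the conjunct
instead); (b) numerics of §8 for non-monotone `D_N`; (c) the `ω₂ → ∞` narrow-band regime as the
place where `c` is smallest at fixed `T`. -/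
theorem why_it_resists : True := trivial

end Summit.AtomisticToContinuum.FouriersLaw.Cruxes.ConductanceLowerBound.Disproof

end
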